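import Summits.RiemannHypothesis.RiemannHypothesis.Theorems.GroundBartaEvenWinsBeyondArchDeflationWindowImageSplit
import Literature.Analysis.ValidatedNumerics.TaylorModelMovingIntegral
import Literature.Analysis.ValidatedNumerics.TaylorModelContract
import Literature.Analysis.ValidatedNumerics.TaylorModelExp
import Literature.NumberTheory.LFunctions.WeilArchDensityPanelTM
import HarnessLib

/-!
# RiemannHypothesis / GroundBarta — rung 4 (`EvenWinsBeyondArch`, stmt-RiemannHypothesis-18807 / 18085):
# the deflated Temple L-side, XV′ — local expansions of the window polynomial and the pole integrals by panel quadrature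

Helper file (`--supports stmt-RiemannHypothesis-18807`), RH-free, Mathlib + landed tree files only, no facts.  Prover B,
speedrun unit `sr-gb-rung-b` (gen 4).  Kernel-feasible (v2, R-LAYER.md §10) replacements of the exact-ℚ pieces of file XVII a:
* `dt_locI` / `dt_locTM` — the interval local expansion `shiftI S (ratPolyI S p) C` of a rational polynomial at an interval
  centre (exact fixed coefficients, `dt_locI_spec`), truncated to a Taylor model (`dt_tmem_locTM`); length lemmas;
* `dt_midPoly` — the midpoint reference polynomial of an interval polynomial;
* `dt_polePanelI` / `dt_poleSumI` — `∫ g(x) e^{qx} dx` over unions of panels of `[-c, c]` by panel quadrature of the product model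
  (`dt_mem_polePanelI`, `dt_mem_poleSumI`), and `dt_mem_poleCosh` / `dt_mem_poleSinh`: enclosures of
  `P_c = ∫_{-c}^{c} g cosh(x/2)`, `P_s = ∫_{-c}^{c} g sinh(x/2)` from enclosures of `I(±½) = ∫_{-c}^{c} g e^{±x/2}` (the exact
  formula of file XVII a, `dt_poleCoshI`, is numerically unusable: it needs `e^{±c/2}` to hundreds of digits).

References: E. Bombieri, Rend. Mat. Acc. Lincei (9) 11 (2000) Thm 2 [Bombieri2000Weil]; K. Makino, M. Berz (2003).
-/

set_option linter.dupNamespace false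

noncomputable section

open MeasureTheory Set Filter intervalIntegral
open scoped Topology BigOperators

namespace Summit.RiemannHypothesis.RiemannHypothesis.Theorems.EvenWinsBeyondArch

open Literature.NumberTheory.LFunctions
open Literature.Analysis.ValidatedNumerics Literature.Analysis.ValidatedNumerics.PolyMP
  Literature.Analysis.ValidatedNumerics.NumericsMP Literature.Analysis.ValidatedNumerics.ExpPoly

/-! ## Local expansions of a rational polynomial -/

/-- The exact interval local expansion of `p` at the interval centre `C`. -/
def dt_locI (S : ℕ) (p : Poly) (C : MI) : IPoly := shiftI S (ratPolyI S p) C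

/-- `addI` has the length of the longer argument. -/
theorem dt_length_addI : ∀ P Q : IPoly, (addI P Q).length = max P.length Q.length
  | [], Q => by simp [addI]
  | I :: P, [] => by simp [addI]
  | I :: P, J :: Q => by simp [addI, dt_length_addI P Q, Nat.add_max_add_right]

/-- `shiftI` preserves the length. -/
theorem dt_length_shiftI (S : ℕ) (c : MI) : ∀ P : IPoly, (shiftI S P c).length = P.length
  | [] => by simp [shiftI]
  | I :: P => by
      have ih := dt_length_shiftI S c P
      simp only [shiftI, List.foldr_cons] at ih ⊢
      simp only [shiftStepI, dt_length_addI, smulI, List.length_map, List.length_cons, ih, List.length_nil]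
      omega

/-- `dt_locI S p C` has the length of `p`. -/
theorem dt_length_locI (S : ℕ) (p : Poly) (C : MI) : (dt_locI S p C).length = p.length := by
  simp [dt_locI, dt_length_shiftI, ratPolyI]

/-- **Soundness**: for `b ∈ C`, `dt_locI S p C` encloses the FIXED coefficients of `s ↦ p(b + s)`, exactly. -/
theorem dt_locI_spec {S : ℕ} (hS : 0 < S) (p : Poly) {b : ℝ} {C : MI} (hb : MI.mem S b C) :
    PMem S (shiftR (p.map ((↑) : ℚ → ℝ)) b) (dt_locI S p C) ∧
      ∀ s, Poly.eval p (b + s) = evalR (shiftR (p.map ((↑) : ℚ → ℝ)) b) s :=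
  ⟨pmem_shiftI hS hb (pmem_ratPoly S p), fun s ↦ by rw [evalR_shiftR, Poly.eval_eq_evalR]⟩

/-- The exact local expansion as a Taylor model on any radius. -/
theorem dt_tmem_locI {S : ℕ} (hS : 0 < S) (R : ℚ) (p : Poly) {b : ℝ} {C : MI} (hb : MI.mem S b C) :
    TMem S R (fun s ↦ Poly.eval p (b + s)) (dt_locI S p C) := fun s _ ↦
  ⟨_, (dt_locI_spec hS p hb).1, (dt_locI_spec hS p hb).2 s⟩

/-- The truncated local model of `p(b + s)`, `|s| ≤ R`. -/
def dt_locTM (S : ℕ) (R : ℚ) (Dl : ℕ) (p : Poly) (C : MI) : IPoly := ttruncI S R Dl (dt_locI S p C)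

/-- Soundness of `dt_locTM`. -/
theorem dt_tmem_locTM {S : ℕ} (hS : 0 < S) {R : ℚ} (hR : 0 ≤ R) (Dl : ℕ) (p : Poly) {b : ℝ} {C : MI}
    (hb : MI.mem S b C) : TMem S R (fun s ↦ Poly.eval p (b + s)) (dt_locTM S R Dl p C) :=
  tmem_trunc hR Dl (dt_tmem_locI hS R p hb)

/-- The midpoint reference polynomial of an interval polynomial. -/
def dt_midPoly (S : ℕ) (P : IPoly) : Poly := P.map fun I ↦ ((I.lo + I.hi : ℤ) : ℚ) / (2 * S)

/-! ## `∫ g e^{qx}` by panel quadrature -/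

/-- One panel: `∫_{-h}^{h} p(b + s) e^{qs} ds` enclosed by integrating the product model against `1`. -/
def dt_polePanelI (S : ℕ) (h : ℚ) (Dl K : ℕ) (p : Poly) (b q : ℚ) : MI :=
  let P := tmulI S h Dl (dt_locTM S h Dl p (ofRat S b)) (texpI S h K q)
  panelIntegI S h P (dt_midPoly S P) [1]

/-- [cite: Bombieri2000Weil, Thm 2 (pole term)] -/
theorem dt_mem_polePanelI {S : ℕ} (hS : 0 < S) {h : ℚ} (hh : 0 ≤ h) (Dl : ℕ) {K : ℕ} (hK : 0 < K) (p : Poly) (b : ℚ)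
    {q : ℚ} (hq : |q * h| ≤ 1) :
    MI.mem S (∫ s in (-(h : ℝ))..h, Poly.eval p ((b : ℝ) + s) * Real.exp ((q : ℝ) * s)) (dt_polePanelI S h Dl K p b q) := by
  unfold dt_polePanelI
  set P := tmulI S h Dl (dt_locTM S h Dl p (ofRat S b)) (texpI S h K q) with hP
  have hT : TMem S h (fun s ↦ Poly.eval p ((b : ℝ) + s) * Real.exp ((q : ℝ) * s)) P :=
    tmem_mul hS hh Dl (dt_tmem_locTM hS hh Dl p (mem_ofRat S b)) (tmem_exp (S := S) hK hq)
  have hcont : Continuous fun s : ℝ ↦ Poly.eval p ((b : ℝ) + s) * Real.exp ((q : ℝ) * s) :=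
    ((Poly.continuous_eval p).comp (continuous_const.add continuous_id)).mul
      (Real.continuous_exp.comp (continuous_const.mul continuous_id))
  have := mem_panelIntegI hS hh hT (hcont.intervalIntegrable _ _) (dt_midPoly S P) [1]
  simpa [Poly.eval] using this

/-- The sum over panels `k₀ ≤ k < k₁` of `[-c, c]` (centres `b_k = −c + (2k+1)h`, `h = c/(2m)`) of `e^{q b_k} · panel_k`. -/
def dt_poleSumI (S : ℕ) (c : ℚ) (m Dl K Ke ke : ℕ) (p : Poly) (q : ℚ) (k0 k1 : ℕ) : MI :=
  (List.range (k1 - k0)).foldl (fun acc j ↦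
    MI.add acc (MI.mul S (expRatMI S Ke ke (q * (-c + (2 * (k0 + j : ℕ) + 1) * (c / (2 * m)))))
      (dt_polePanelI S (c / (2 * m)) Dl K p (-c + (2 * (k0 + j : ℕ) + 1) * (c / (2 * m))) q))) (MI.ofScaled 0)

/-- Success of the exponential enclosures used by `dt_poleSumI`. -/
def dt_poleSumCheck (S : ℕ) (c : ℚ) (m Ke ke : ℕ) (q : ℚ) (k0 k1 : ℕ) : Bool :=
  (List.range (k1 - k0)).all fun j ↦
    (MI.expPt S Ke ke (ofRat S (q * (-c + (2 * (k0 + j : ℕ) + 1) * (c / (2 * m)))))).isSome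

/-- **Panel quadrature of `∫ g e^{qx}`**: `dt_poleSumI … k₀ k₁ ∋ ∫_{−c+2k₀h}^{−c+2k₁h} p(x) e^{qx} dx` (`k₀ ≤ k₁`, `|q h| ≤ 1`).
[cite: Bombieri2000Weil, Thm 2 (pole term)] -/
theorem dt_mem_poleSumI {S : ℕ} (hS : 0 < S) {c : ℚ} (hc : 0 < c) {m : ℕ} (hm : 0 < m) (Dl : ℕ) {K : ℕ} (hK : 0 < K)
    (Ke ke : ℕ) (p : Poly) {q : ℚ} (hq : |q * (c / (2 * m))| ≤ 1) {k0 k1 : ℕ} (hk : k0 ≤ k1)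
    (hchk : dt_poleSumCheck S c m Ke ke q k0 k1 = true) :
    MI.mem S (∫ x in ((-c + 2 * k0 * (c / (2 * m)) : ℚ) : ℝ)..((-c + 2 * k1 * (c / (2 * m)) : ℚ) : ℝ),
      Poly.eval p x * Real.exp ((q : ℝ) * x)) (dt_poleSumI S c m Dl K Ke ke p q k0 k1) := by
  obtain ⟨n, rfl⟩ : ∃ n, k1 = k0 + n := ⟨k1 - k0, by omega⟩
  unfold dt_poleSumI dt_poleSumCheck at *
  simp only [Nat.add_sub_cancel_left] at hchk ⊢
  set h : ℚ := c / (2 * m) with hh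
  have hmq : (0 : ℚ) < m := by exact_mod_cast hm
  have hh0 : 0 ≤ h := by rw [hh]; positivity
  have hcont : Continuous fun x : ℝ ↦ Poly.eval p x * Real.exp ((q : ℝ) * x) :=
    (Poly.continuous_eval p).mul (Real.continuous_exp.comp (continuous_const.mul continuous_id))
  induction n with
  | zero =>
      simp only [add_zero, List.range_zero, List.foldl_nil, intervalIntegral.integral_same]
      exact mem_zero_ofScaled S
  | succ n ih =>
      have hchk' : ((List.range n).all fun j ↦
          (MI.expPt S Ke ke (ofRat S (q * (-c + (2 * ((k0 + j : ℕ) : ℚ) + 1) * h)))).isSome) = true := by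
        rw [List.all_eq_true] at hchk ⊢
        intro j hj
        exact hchk j (by simp at hj ⊢; omega)
      have ih' := ih (by omega) hchk'
      rw [List.range_succ, List.foldl_append, List.foldl_cons, List.foldl_nil]
      -- split the interval at `−c + 2(k0+n)h`
      have hsplit : ∫ x in ((-c + 2 * k0 * h : ℚ) : ℝ)..((-c + 2 * ((k0 + (n + 1) : ℕ) : ℚ) * h : ℚ) : ℝ),
            Poly.eval p x * Real.exp ((q : ℝ) * x) =
          (∫ x in ((-c + 2 * k0 * h : ℚ) : ℝ)..((-c + 2 * ((k0 + n : ℕ) : ℚ) * h : ℚ) : ℝ),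
            Poly.eval p x * Real.exp ((q : ℝ) * x)) +
          ∫ x in ((-c + 2 * ((k0 + n : ℕ) : ℚ) * h : ℚ) : ℝ)..((-c + 2 * ((k0 + (n + 1) : ℕ) : ℚ) * h : ℚ) : ℝ),
            Poly.eval p x * Real.exp ((q : ℝ) * x) :=
        (intervalIntegral.integral_add_adjacent_intervals (hcont.intervalIntegrable _ _)
          (hcont.intervalIntegrable _ _)).symm
      rw [hsplit]
      refine MI.mem_add ?_ ?_
      · exact ih'
      · -- the last panel, centre `b = −c + (2(k0+n)+1)h`
        set b : ℚ := -c + (2 * ((k0 + n : ℕ) : ℚ) + 1) * h with hb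
        have hexp := mem_expRatMI hS (List.all_eq_true.1 hchk n (by simp))
        have hpan := dt_mem_polePanelI hS hh0 Dl hK p b hq
        have key : ∫ x in ((-c + 2 * ((k0 + n : ℕ) : ℚ) * h : ℚ) : ℝ)..((-c + 2 * ((k0 + (n + 1) : ℕ) : ℚ) * h : ℚ) : ℝ),
            Poly.eval p x * Real.exp ((q : ℝ) * x) =
            Real.exp (((q * b : ℚ) : ℝ)) * ∫ s in (-(h : ℝ))..h, Poly.eval p ((b : ℝ) + s) * Real.exp ((q : ℝ) * s) := by
          have hcv := intervalIntegral.integral_comp_add_right (fun x ↦ Poly.eval p x * Real.exp ((q : ℝ) * x)) (b : ℝ)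
            (a := -(h : ℝ)) (b := h)
          have e1 : -(h : ℝ) + b = ((-c + 2 * ((k0 + n : ℕ) : ℚ) * h : ℚ) : ℝ) := by
            simp only [hb]; push_cast; ring
          have e2 : (h : ℝ) + b = ((-c + 2 * ((k0 + (n + 1) : ℕ) : ℚ) * h : ℚ) : ℝ) := by
            simp only [hb]; push_cast; ring
          rw [e1, e2] at hcv
          rw [← hcv, ← intervalIntegral.integral_const_mul]
          refine intervalIntegral.integral_congr fun s _ ↦ ?_
          rw [show (q : ℝ) * (s + b) = ((q * b : ℚ) : ℝ) + (q : ℝ) * s by push_cast; ring, Real.exp_add]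
          ring
        rw [key]
        exact MI.mem_mul hS hexp hpan

/-! ## `P_c`, `P_s` from the two exponential integrals -/

/-- `∫_{-c}^{c} g cosh(x/2) ∈ (I⁺ + I⁻)/2` from `I^± ∋ ∫_{-c}^{c} g e^{±x/2}`. [cite: Bombieri2000Weil, Thm 2 (pole term)] -/
theorem dt_mem_poleCosh {S : ℕ} {c : ℝ} (p : Poly) {Ip Im : MI}
    (hIp : MI.mem S (∫ x in (-c)..c, Poly.eval p x * Real.exp (((1 / 2 : ℚ) : ℝ) * x)) Ip)
    (hIm : MI.mem S (∫ x in (-c)..c, Poly.eval p x * Real.exp (((-(1 / 2) : ℚ) : ℝ) * x)) Im) :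
    MI.mem S (∫ x in (-c)..c, Poly.eval p x * Real.cosh (x / 2)) (MI.divNat (MI.add Ip Im) 2) := by
  have hcont : ∀ q : ℝ, Continuous fun x : ℝ ↦ Poly.eval p x * Real.exp (q * x) := fun q ↦
    (Poly.continuous_eval p).mul (Real.continuous_exp.comp (continuous_const.mul continuous_id))
  have e : ∫ x in (-c)..c, Poly.eval p x * Real.cosh (x / 2) =
      ((∫ x in (-c)..c, Poly.eval p x * Real.exp (((1 / 2 : ℚ) : ℝ) * x)) +
        ∫ x in (-c)..c, Poly.eval p x * Real.exp (((-(1 / 2) : ℚ) : ℝ) * x)) / (2 : ℕ) := by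
    rw [← intervalIntegral.integral_add ((hcont _).intervalIntegrable _ _) ((hcont _).intervalIntegrable _ _),
      Nat.cast_ofNat, eq_div_iff two_ne_zero, ← intervalIntegral.integral_mul_const]
    refine intervalIntegral.integral_congr fun x _ ↦ ?_
    simp only [Real.cosh_eq]
    push_cast
    rw [show x / 2 = 1 / 2 * x by ring, show -(1 / 2 * x) = -(1 / 2) * x by ring]
    ring
  rw [e]
  exact MI.mem_divNat (MI.mem_add hIp hIm) two_pos

/-- `∫_{-c}^{c} g sinh(x/2) ∈ (I⁺ − I⁻)/2`. [cite: Bombieri2000Weil, Thm 2 (pole term)] -/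
theorem dt_mem_poleSinh {S : ℕ} {c : ℝ} (p : Poly) {Ip Im : MI}
    (hIp : MI.mem S (∫ x in (-c)..c, Poly.eval p x * Real.exp (((1 / 2 : ℚ) : ℝ) * x)) Ip)
    (hIm : MI.mem S (∫ x in (-c)..c, Poly.eval p x * Real.exp (((-(1 / 2) : ℚ) : ℝ) * x)) Im) :
    MI.mem S (∫ x in (-c)..c, Poly.eval p x * Real.sinh (x / 2)) (MI.divNat (MI.sub Ip Im) 2) := by
  have hcont : ∀ q : ℝ, Continuous fun x : ℝ ↦ Poly.eval p x * Real.exp (q * x) := fun q ↦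
    (Poly.continuous_eval p).mul (Real.continuous_exp.comp (continuous_const.mul continuous_id))
  have e : ∫ x in (-c)..c, Poly.eval p x * Real.sinh (x / 2) =
      ((∫ x in (-c)..c, Poly.eval p x * Real.exp (((1 / 2 : ℚ) : ℝ) * x)) -
        ∫ x in (-c)..c, Poly.eval p x * Real.exp (((-(1 / 2) : ℚ) : ℝ) * x)) / (2 : ℕ) := by
    rw [← intervalIntegral.integral_sub ((hcont _).intervalIntegrable _ _) ((hcont _).intervalIntegrable _ _),
      Nat.cast_ofNat, eq_div_iff two_ne_zero, ← intervalIntegral.integral_mul_const]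
    refine intervalIntegral.integral_congr fun x _ ↦ ?_
    simp only [Real.sinh_eq]
    push_cast
    rw [show x / 2 = 1 / 2 * x by ring, show -(1 / 2 * x) = -(1 / 2) * x by ring]
    ring
  rw [e]
  exact MI.mem_divNat (MI.mem_sub hIp hIm) two_pos

end Summit.RiemannHypothesis.RiemannHypothesis.Theorems.EvenWinsBeyondArch

end
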